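import Mathlib
import HarnessLib
import Summits.ValiantsHypothesis.ValiantsHypothesis.Theses.MonotoneRestoration
import Literature.Computability.AlgebraicComplexity.SymmetricCircuitSubstitution
import Literature.Computability.AlgebraicComplexity.SymmetricCircuitScaledInputs
import Literature.Computability.AlgebraicComplexity.SymmetricCircuitLinCombSymmetry
import Summits.ValiantsHypothesis.ValiantsHypothesis.Theorems.MonotoneRestorationMonotoneRestorationQPHomogeneousComponentVandermonde

/-! # Route MonotoneRestoration — crux `MonotoneRestorationQP`, line Sketch v10: THEOREM ζ-H
(stmt-ValiantsHypothesis-15886, lead c5)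

**Symmetric circuit size is closed under scaling and under homogeneous components.**
Part of THEOREM ζ (the SIZE CALCULUS of Dawar–Wilsenach square-symmetric circuits). From the
landed stubs Z1 (substitution, `IsSymmetric.exists_substitution`, p161502), Z2 (scaled inputs,
`exists_scaledInputs`, p161489), Z6 (Vandermonde extraction,
`stub_homogeneousComponent_vandermonde`, p161573) and the tree's linear combinations
(`IsSymmetric.exists_linComb`):

* `zeta_symmetric_scale` — `f(t · x)` on `|G| + 2|X| + 1` gates;
* `zeta_symmetric_scaledSum` — `Σ_{j ≤ m} v_j · f(t_j · x)` on `(m + 2)(|G| + 2|X| + 9)` gates;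
* `zeta_symmetric_homogeneousComponent` — over a field of characteristic `0`, every homogeneous
  component of a symmetrically computed `f` of total degree `≤ d` is symmetrically computed on
  `(d + 2)(|G| + 2|X| + 9)` gates (interpolation at the nodes `0, 1, …, d`);
* `zeta_poly_mul_qp_le` — the quasi-polynomial bookkeeping `A (n+2)^{c₁} 2^{a (log₂ n + c₂)^{c₂}}
  ≤ 2^{(log₂ n + c₃)^{c₃}}`;
* `qpSymmetric_homogeneousComponent` — COROLLARY AT THE CRUX'S SCALE: if a family `f_n` of
  polynomial degree has square-symmetric circuits over `ℂ` of quasi-polynomial size, so does every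
  family of homogeneous components `(f_n)^{(k_n)}` — the conclusion class of `MonotoneRestorationQP`
  (equivalently, by THEOREM ε, of complex matrix-symmetric restoration) is closed under taking
  homogeneous components, so restoration may be attempted degree by degree.
-/

noncomputable section

-- `Summit.ValiantsHypothesis.ValiantsHypothesis.…` is the tree's mandated namespace (Sub = Summit).
set_option linter.dupNamespace false

namespace Summit.ValiantsHypothesis.ValiantsHypothesis.Theorems

open Literature.Computability.AlgebraicComplexity

/-! ### Scaling and scaled sums -/

/-- **ζ-H1 — scaling.** A `Γ`-symmetrically computed `f` over a finite `Γ`-set of variables has its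
scaled copy `f(t · x)` (`MvPolynomial.aeval (x ↦ t · x)`) computed `Γ`-symmetrically on at most
`|G| + 2|X| + 1` gates: the scaled-inputs layer (Z2) substituted into the circuit (Z1). [folklore] -/
theorem zeta_symmetric_scale {K X Γ G : Type} [CommSemiring K] [Group Γ] [MulAction Γ X]
    [MulAction Γ Unit] [Fintype X] [DecidableEq X] [Fintype G]
    (C : LabelledArithCircuit K X Unit G) (hC : C.IsSymmetric Γ) (t : K) :
    ∃ (G' : Type) (_ : Fintype G') (C' : LabelledArithCircuit K X Unit G'),
      C'.IsSymmetric Γ ∧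
      C'.eval (C'.output ()) =
        MvPolynomial.aeval (fun x : X => MvPolynomial.C t * MvPolynomial.X x)
          (C.eval (C.output ())) ∧
      Fintype.card G' ≤ Fintype.card G + 2 * Fintype.card X + 1 := by
  obtain ⟨G₁, i₁, C₁, h₁, hev₁, hc₁⟩ :=
    LabelledArithCircuit.exists_scaledInputs (K := K) (X := X) Γ t
  obtain ⟨G', i', C', h', hev', hc'⟩ := h₁.exists_substitution hC
  have hfun : (fun x' => C₁.eval (C₁.output x')) =
      fun x : X => MvPolynomial.C t * MvPolynomial.X x := funext hev₁
  refine ⟨G', i', C', h', ?_, hc'.trans (by omega)⟩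
  rw [hev' (), hfun]

/-- **ζ-H2 — scaled sums.** For nodes `t_j` and coefficients `v_j`, the combination
`Σ_{j ≤ m} v_j · f(t_j · x)` of scaled copies of a `Γ`-symmetrically computed `f` is computed
`Γ`-symmetrically on at most `(m + 2)(|G| + 2|X| + 9)` gates (ζ-H1 and iterated linear
combinations `exists_linComb`). [folklore] -/
theorem zeta_symmetric_scaledSum {K X Γ G : Type} [CommSemiring K] [Group Γ] [MulAction Γ X]
    [MulAction Γ Unit] [Fintype X] [DecidableEq X] [Fintype G]
    (C : LabelledArithCircuit K X Unit G) (hC : C.IsSymmetric Γ) (t v : ℕ → K) (m : ℕ) :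
    ∃ (G' : Type) (_ : Fintype G') (C' : LabelledArithCircuit K X Unit G'),
      C'.IsSymmetric Γ ∧
      C'.eval (C'.output ()) =
        ∑ j ∈ Finset.range (m + 1), MvPolynomial.C (v j) *
          MvPolynomial.aeval (fun x : X => MvPolynomial.C (t j) * MvPolynomial.X x)
            (C.eval (C.output ())) ∧
      Fintype.card G' ≤ (m + 2) * (Fintype.card G + 2 * Fintype.card X + 9) := by
  induction m with
  | zero =>
    obtain ⟨G₀, i₀, C₀, h₀, hev₀, hc₀⟩ := zeta_symmetric_scale C hC (t 0)
    obtain ⟨G', i', C', h', hev', hc'⟩ := h₀.exists_linComb C₀ C₀ h₀ (v 0) 0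
    refine ⟨G', i', C', h', ?_, ?_⟩
    · rw [hev', hev₀, zero_add, Finset.sum_range_one, map_zero, zero_mul, add_zero]
    · calc Fintype.card G' ≤ Fintype.card G₀ + Fintype.card G₀ + 8 := hc'
        _ ≤ (0 + 2) * (Fintype.card G + 2 * Fintype.card X + 9) := by omega
  | succ m ih =>
    obtain ⟨Gm, im, Cm, hm, hevm, hcm⟩ := ih
    obtain ⟨G₀, i₀, C₀, h₀, hev₀, hc₀⟩ := zeta_symmetric_scale C hC (t (m + 1))
    obtain ⟨G', i', C', h', hev', hc'⟩ := hm.exists_linComb Cm C₀ h₀ 1 (v (m + 1))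
    refine ⟨G', i', C', h', ?_, ?_⟩
    · rw [hev', hevm, hev₀, Finset.sum_range_succ _ (m + 1), map_one, one_mul]
    · calc Fintype.card G' ≤ Fintype.card Gm + Fintype.card G₀ + 8 := hc'
        _ ≤ (m + 2) * (Fintype.card G + 2 * Fintype.card X + 9) +
              (Fintype.card G + 2 * Fintype.card X + 1) + 8 := by omega
        _ = (m + 1 + 2) * (Fintype.card G + 2 * Fintype.card X + 9) := by ring

/-! ### Homogeneous components -/

/-- **ζ-H3 — SYMMETRIC CIRCUIT SIZE IS CLOSED UNDER HOMOGENEOUS COMPONENTS.** Over a field of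
characteristic `0`: if a `Γ`-symmetric single-output circuit on `|G|` gates over a finite `Γ`-set of
variables `X` computes `f` of total degree `≤ d`, then for every `k` the homogeneous component
`f^{(k)}` is computed by a `Γ`-symmetric circuit on at most `(d + 2)(|G| + 2|X| + 9)` gates:
interpolation of `t ↦ f(t · x) = Σ_i t^i f^{(i)}` at the nodes `0, 1, …, d` (Vandermonde, Z6) —
and `f^{(k)} = 0` for `k > d`, computed by the same combination with zero coefficients. Scaling
commutes with every permutation of the variables, which is why no symmetry is lost (contrast:
Strassen's homogenisation of a non-symmetric circuit splits every gate by degree). [folklore] -/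
theorem zeta_symmetric_homogeneousComponent {K X Γ G : Type} [Field K] [CharZero K] [Group Γ]
    [MulAction Γ X] [MulAction Γ Unit] [Fintype X] [DecidableEq X] [Fintype G]
    (C : LabelledArithCircuit K X Unit G) (hC : C.IsSymmetric Γ) {d : ℕ}
    (hd : (C.eval (C.output ())).totalDegree ≤ d) (k : ℕ) :
    ∃ (G' : Type) (_ : Fintype G') (C' : LabelledArithCircuit K X Unit G'),
      C'.IsSymmetric Γ ∧
      C'.eval (C'.output ()) = MvPolynomial.homogeneousComponent k (C.eval (C.output ())) ∧
      Fintype.card G' ≤ (d + 2) * (Fintype.card G + 2 * Fintype.card X + 9) := by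
  set f := C.eval (C.output ()) with hf
  -- nodes 0, 1, …, d (distinct in characteristic 0)
  let t : ℕ → K := fun j => (j : K)
  let tF : Fin (d + 1) → K := fun j => (j : ℕ)
  have htF : Function.Injective tF := fun a b hab =>
    Fin.ext (Nat.cast_injective (R := K) hab)
  by_cases hk : k ≤ d
  · -- coefficients: row `k` of the inverse Vandermonde matrix
    let kF : Fin (d + 1) := ⟨k, Nat.lt_succ_of_le hk⟩
    let v : ℕ → K := fun j =>
      if h : j < d + 1 then (Matrix.vandermonde tF)⁻¹ kF ⟨j, h⟩ else 0
    obtain ⟨G', i', C', h', hev', hc'⟩ := zeta_symmetric_scaledSum C hC t v d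
    refine ⟨G', i', C', h', ?_, hc'⟩
    rw [hev', Finset.sum_range (fun j => MvPolynomial.C (v j) *
      MvPolynomial.aeval (fun x : X => MvPolynomial.C (t j) * MvPolynomial.X x) f)]
    have key := stub_homogeneousComponent_vandermonde f hd tF htF kF
    rw [← key]
    refine Finset.sum_congr rfl fun j _ => ?_
    rw [MvPolynomial.smul_eq_C_mul]
    have hv : v j = (Matrix.vandermonde tF)⁻¹ kF j := by
      simp only [v, dif_pos j.isLt]
    rw [hv]
  · -- `k > d`: the component vanishes; all coefficients zero
    obtain ⟨G', i', C', h', hev', hc'⟩ := zeta_symmetric_scaledSum C hC t (fun _ => 0) d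
    refine ⟨G', i', C', h', ?_, hc'⟩
    rw [hev', MvPolynomial.homogeneousComponent_eq_zero k f (by omega)]
    simp only [map_zero, zero_mul, Finset.sum_const_zero]

/-! ### Quasi-polynomial bookkeeping -/

/-- **Quasi-polynomial bookkeeping.** A constant times a polynomial in `n` times a power of a
quasi-polynomial `2^{(log₂ n + c₂)^{c₂}}` is again bounded by a quasi-polynomial
`2^{(log₂ n + c₃)^{c₃}}`, uniformly in `n`. [folklore] -/
theorem zeta_poly_mul_qp_le (A c₁ c₂ a : ℕ) : ∃ c₃ : ℕ, ∀ n : ℕ,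
    A * (n + 2) ^ c₁ * 2 ^ (a * (Nat.log 2 n + c₂) ^ c₂) ≤ 2 ^ ((Nat.log 2 n + c₃) ^ c₃) := by
  refine ⟨A + 2 * c₁ + a + c₂ + 3, fun n => ?_⟩
  have hL : n < 2 ^ (Nat.log 2 n + 1) := Nat.lt_pow_succ_log_self Nat.one_lt_two n
  generalize Nat.log 2 n = L at hL ⊢
  set B : ℕ := L + (A + 2 * c₁ + a + c₂ + 3) with hB
  have hB3 : 3 ≤ B := by omega
  have hB1 : 1 ≤ B := by omega
  -- the three factors as powers of two
  have hA : A ≤ 2 ^ A := Nat.lt_two_pow_self.le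
  have hn2 : n + 2 ≤ 2 ^ (L + 2) := by
    have : 2 ^ (L + 2) = 2 ^ (L + 1) * 2 := by ring
    omega
  have hP : (n + 2) ^ c₁ ≤ 2 ^ ((L + 2) * c₁) := by
    calc (n + 2) ^ c₁ ≤ (2 ^ (L + 2)) ^ c₁ := Nat.pow_le_pow_left hn2 _
      _ = 2 ^ ((L + 2) * c₁) := (pow_mul 2 (L + 2) c₁).symm
  -- the exponent
  have hE : A + (L + 2) * c₁ + a * (L + c₂) ^ c₂ ≤ B ^ (A + 2 * c₁ + a + c₂ + 3) := by
    have h1 : A ≤ B := by omega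
    have h2 : (L + 2) * c₁ ≤ B * B := Nat.mul_le_mul (by omega) (by omega)
    have h3 : a * (L + c₂) ^ c₂ ≤ B * B ^ c₂ :=
      Nat.mul_le_mul (by omega) (Nat.pow_le_pow_left (by omega) _)
    have hBB : B * B = B ^ 2 := (sq B).symm
    have hBc : B * B ^ c₂ = B ^ (c₂ + 1) := by ring
    have hmono : ∀ i j : ℕ, i ≤ j → B ^ i ≤ B ^ j := fun i j hij => Nat.pow_le_pow_right hB1 hij
    have hsum : A + (L + 2) * c₁ + a * (L + c₂) ^ c₂ ≤ 3 * B ^ (c₂ + 2) := by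
      have e1 : B ≤ B ^ (c₂ + 2) := by
        calc B = B ^ 1 := (pow_one B).symm
          _ ≤ B ^ (c₂ + 2) := hmono 1 (c₂ + 2) (by omega)
      have e2 : B ^ 2 ≤ B ^ (c₂ + 2) := hmono 2 (c₂ + 2) (by omega)
      have e3 : B ^ (c₂ + 1) ≤ B ^ (c₂ + 2) := hmono (c₂ + 1) (c₂ + 2) (by omega)
      rw [hBB] at h2
      rw [hBc] at h3
      omega
    calc A + (L + 2) * c₁ + a * (L + c₂) ^ c₂ ≤ 3 * B ^ (c₂ + 2) := hsum
      _ ≤ B * B ^ (c₂ + 2) := Nat.mul_le_mul_right _ hB3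
      _ = B ^ (c₂ + 3) := by ring
      _ ≤ B ^ (A + 2 * c₁ + a + c₂ + 3) := hmono _ _ (by omega)
  calc A * (n + 2) ^ c₁ * 2 ^ (a * (L + c₂) ^ c₂)
      ≤ 2 ^ A * 2 ^ ((L + 2) * c₁) * 2 ^ (a * (L + c₂) ^ c₂) :=
        Nat.mul_le_mul_right _ (Nat.mul_le_mul hA hP)
    _ = 2 ^ (A + (L + 2) * c₁ + a * (L + c₂) ^ c₂) := by rw [← pow_add, ← pow_add]
    _ ≤ 2 ^ (B ^ (A + 2 * c₁ + a + c₂ + 3)) := Nat.pow_le_pow_right (by norm_num) hE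

/-- Monotonicity of the quasi-polynomial scale in its exponent: `(L + c)^c ≤ (L + c')^{c'}` for
`c ≤ c'`. [folklore] -/
theorem zeta_polylog_mono {c c' : ℕ} (h : c ≤ c') (L : ℕ) : (L + c) ^ c ≤ (L + c') ^ c' := by
  rcases Nat.eq_zero_or_pos c' with h0 | hpos
  · subst h0
    have : c = 0 := by omega
    subst this; exact le_rfl
  · calc (L + c) ^ c ≤ (L + c') ^ c := Nat.pow_le_pow_left (by omega) _
      _ ≤ (L + c') ^ c' := Nat.pow_le_pow_right (by omega) h

/-! ### The corollary at the crux's scale -/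

/-- **THEOREM ζ-H — the conclusion class of the crux is closed under homogeneous components.**
If a family `f_n ∈ ℂ[x_ij : i, j < n]` of polynomial total degree has square-symmetric circuits
(diagonal action of `Sym(Fin n)`) of quasi-polynomial size `2^{(log₂ n + c)^c}`, then for ANY
choice of degrees `k_n` the family of homogeneous components `(f_n)^{(k_n)}` has square-symmetric
circuits of quasi-polynomial size. In particular restoration (the crux `MonotoneRestorationQP`,
equivalently complex matrix-symmetric restoration by THEOREM ε) may be proved or refuted on
HOMOGENEOUS families. [folklore] -/
theorem qpSymmetric_homogeneousComponent :
    ∀ (f : (n : ℕ) → MvPolynomial (Fin n × Fin n) ℂ) (k : ℕ → ℕ),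
      (∃ c : ℕ, ∀ n : ℕ, (f n).totalDegree ≤ (n + 2) ^ c) →
      (∃ c : ℕ, ∀ n : ℕ, ∃ (G : Type) (_ : Fintype G)
        (C : LabelledArithCircuit ℂ (Fin n × Fin n) Unit G),
        C.IsSymmetric (Equiv.Perm (Fin n)) ∧ C.eval (C.output ()) = f n ∧
          Fintype.card G ≤ 2 ^ ((Nat.log 2 n + c) ^ c)) →
      ∃ c : ℕ, ∀ n : ℕ, ∃ (G : Type) (_ : Fintype G)
        (C : LabelledArithCircuit ℂ (Fin n × Fin n) Unit G),
        C.IsSymmetric (Equiv.Perm (Fin n)) ∧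
          C.eval (C.output ()) = MvPolynomial.homogeneousComponent (k n) (f n) ∧
          Fintype.card G ≤ 2 ^ ((Nat.log 2 n + c) ^ c) := by
  intro f k hdeg hqp
  obtain ⟨c₁, hc₁⟩ := hdeg
  obtain ⟨c₂, hc₂⟩ := hqp
  -- size `(d+2)(s + 2n² + 9) ≤ 36 (n+2)^{c₁+2} 2^{M}`
  obtain ⟨c₃, hc₃⟩ := zeta_poly_mul_qp_le 36 (c₁ + 2) c₂ 1
  refine ⟨c₃, fun n => ?_⟩
  obtain ⟨G, inst, C, hsym, hev, hcard⟩ := hc₂ n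
  have hd : (C.eval (C.output ())).totalDegree ≤ (n + 2) ^ c₁ := hev ▸ hc₁ n
  obtain ⟨G', i', C', h', hev', hc'⟩ := zeta_symmetric_homogeneousComponent C hsym hd (k n)
  refine ⟨G', i', C', h', by rw [hev', hev], hc'.trans (le_trans ?_ (hc₃ n))⟩
  -- arithmetic
  set M := 2 ^ ((Nat.log 2 n + c₂) ^ c₂) with hM
  have hM1 : 1 ≤ M := Nat.one_le_two_pow
  have hX : Fintype.card (Fin n × Fin n) = n * n := by simp
  rw [hX, one_mul]
  have h1 : (n + 2) ^ c₁ + 2 ≤ 3 * (n + 2) ^ c₁ := by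
    have : 1 ≤ (n + 2) ^ c₁ := Nat.one_le_pow _ _ (by omega)
    omega
  have h2 : Fintype.card G + 2 * (n * n) + 9 ≤ 12 * (n + 2) ^ 2 * M := by
    have hnn : 2 * (n * n) + 9 ≤ 11 * (n + 2) ^ 2 := by nlinarith
    have h22 : 1 ≤ (n + 2) ^ 2 := Nat.one_le_pow _ _ (by omega)
    calc Fintype.card G + 2 * (n * n) + 9 ≤ M + 11 * (n + 2) ^ 2 := by omega
      _ ≤ (n + 2) ^ 2 * M + 11 * (n + 2) ^ 2 * M := by nlinarith
      _ = 12 * (n + 2) ^ 2 * M := by ring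
  calc ((n + 2) ^ c₁ + 2) * (Fintype.card G + 2 * (n * n) + 9)
      ≤ (3 * (n + 2) ^ c₁) * (12 * (n + 2) ^ 2 * M) := Nat.mul_le_mul h1 h2
    _ = 36 * (n + 2) ^ (c₁ + 2) * M := by ring

end Summit.ValiantsHypothesis.ValiantsHypothesis.Theorems

end
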